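import Summits.KontsevichZagierPeriods.KontsevichZagierPeriods.Theorems.HermiteRigidityReductionRigidityEulerGen
import Summits.KontsevichZagierPeriods.KontsevichZagierPeriods.Theorems.HermiteRigidityReductionRigidityMonomialDivisionGen
import Summits.KontsevichZagierPeriods.KontsevichZagierPeriods.Theorems.HermiteRigidityReductionRigidityLineReduction
import Literature.NumberTheory.Transcendental.KZRulesAssociator

/-!
# KontsevichZagierPeriods / HermiteRigidity — crux `ReductionRigidity` (stmt-KontsevichZagierPeriods-3407), line `Sketch` (Padé box island, EVERY weight): the GENERAL REDUCTION

Route `KontsevichZagierPeriods/HermiteRigidity`, crux stmt-KontsevichZagierPeriods-3407 (`ReductionRigidity`),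
crux-chain line `Sketch` (skeleton `Cruxes/ReductionRigidity/Lines/Sketch.lean`, v7). Glue of the lead over the
four landed general stubs `stub_torusGen`, `stub_eulerGen`, `stub_monomialGen`, `stub_divisionGen`:

* `genReduction` — for every RATIONAL level `ν` with `ν > 1` or `ν < 0` (integer `N ≥ 2`: `stub_genReduction`) and
  every `w`, every RESCALED box generator of dimension `j ≤ w` on the
  closed unit cube, `[□ʲ, q·x^a/(ν − x₀⋯x_{j−1})^m]` (`a : Fin j → ℕ`, `q ∈ ℚ`, `m ∈ ℕ`), is congruent
  modulo `KZ.relations` to a NORMAL FORM with RATIONAL coefficients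

    `Σ_{i ≤ w} [□ⁱ, αᵢ/(ν − x₀⋯x_{i−1})]`,  `αᵢ ∈ ℚ`

  (values `Σ αᵢ·Lᵢ`, `L₀ = 1/(ν − 1)`, `Lᵢ = Li_i(1/ν)` for `i ≥ 1`; `ν < 0` covers the alternating points). Induction on the dimension `j`, then on
  the pole order `m`: `j = 0` constants; `m = 0` monomials; unbalanced exponents → torus exactness to two
  faces of dimension `j − 1`; balanced → Euler descent down to `m = 1`, then the division
  `u^c = N^c − (N − u)·Σ N^{c−1−i} u^i`;
* the normal-form bookkeeping `gnf_*` (spelled out as an existential, no definition), consumed by the island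
  theorem of the companion file `HermiteRigidityReductionRigidityPadeBoxIslandsAllWeights.lean`.

Unconditional; only cubical moves of the Kontsevich–Zagier calculus with rational primitives regular on the
closed cube — no variable is ever integrated out (the barrier `noSemialgebraicPrimitive_inv_sub_two` is not
met); the transcendental `Li_i(1/N)` stay as normal-form VALUES.

References: M. Kontsevich, D. Zagier, *Periods* (2001), §1.2 [cite: KontsevichZagier2001, §1.2];
J. Ayoub, EMS Newsl. 91 (2014), Def. 10 [cite: Ayoub2014, Def. 10].
-/

noncomputable section

open MeasureTheory Set MvPolynomial

namespace Summit.KontsevichZagierPeriods.HermiteRigidity.ReductionRigidity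

open Literature.NumberTheory.Transcendental
open Literature.NumberTheory.Transcendental.KZ

/-! ## Toolkit -/

/-- For a rational level `ν > 1` or `ν < 0`, `ν − 1 ≠ 0`. [folklore] -/
theorem nu_sub_one_ne {ν : ℚ} (hν : 1 < ν ∨ ν < 0) : (ν : ℝ) - 1 ≠ 0 := by
  rcases hν with h | h
  · have : (1 : ℝ) < ν := by exact_mod_cast h
    intro h0; linarith
  · have : (ν : ℝ) < 0 := by exact_mod_cast h
    intro h0; linarith

/-- The rescaled generator `[□ʲ, q x^a/(ν − ∏x)^m]` exists. [cite: KontsevichZagier2001, §1.1] -/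
theorem exists_genRep {j : ℕ} {ν : ℚ} (hν : 1 < ν ∨ ν < 0) (q : ℚ) (a : Fin j → ℕ) (m : ℕ) :
    ∃ r : IntegralRep j, r.domain = cube j ∧
      EqOn r.integrand (fun p => (q : ℝ) * (∏ i, p i ^ a i) / ((ν : ℝ) - ∏ i, p i) ^ m) (cube j) := by
  refine ⟨(⟨C q * ∏ i, X i ^ a i, (C ν - ∏ i, X i) ^ m, torusGen_den_ne hν m⟩ : RFun j).rep, rfl,
    fun x _ => ?_⟩
  simp [RFun.rep_integrand, RFun.fn, map_prod]

/-- The normal form `[□ⁱ, α/(ν − ∏x)]` exists. [cite: KontsevichZagier2001, §1.1] -/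
theorem exists_nfRep {i : ℕ} {ν : ℚ} (hν : 1 < ν ∨ ν < 0) (α : ℚ) :
    ∃ s : IntegralRep i, s.domain = cube i ∧
      EqOn s.integrand (fun p => (α : ℝ) / ((ν : ℝ) - ∏ l, p l)) (cube i) := by
  refine ⟨(⟨C α, (C ν - ∏ l, X l) ^ 1, torusGen_den_ne hν 1⟩ : RFun i).rep, rfl, fun x _ => ?_⟩
  simp [RFun.rep_integrand, RFun.fn, map_prod]

/-- The normal-form family in dimension `i` is additive in its parameter. [folklore] -/
theorem nfFamily_add (ν : ℚ) (i : ℕ) : ∀ (β β' : ℚ) (p : Fin i → ℝ),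
    (((β + β' : ℚ) : ℝ) / ((ν : ℝ) - ∏ l, p l)) = (β : ℝ) / ((ν : ℝ) - ∏ l, p l) + (β' : ℝ) / ((ν : ℝ) - ∏ l, p l) := by
  intro β β' p; push_cast; ring

/-! ## Normal-form bookkeeping (`x ≡ Σ_{i ≤ w} [□ⁱ, αᵢ/(N − ∏x)]`, spelled out) -/

/-- `GNF w ν x`: `x` is congruent to a rational normal form `Σ_{i ≤ w} [□ⁱ, αᵢ/(ν − ∏x)]` — spelled as
an existential so that no definition is needed downstream. Here: ZERO has a normal form (all carriers
with parameter `0` are relations). [cite: KontsevichZagier2001, §1.2 rule (1)] -/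
theorem gnf_zero {ν : ℚ} (hν : 1 < ν ∨ ν < 0) (w : ℕ) :
    ∃ (α : ℕ → ℚ) (s : (i : ℕ) → IntegralRep i),
      (∀ i, (s i).domain = cube i ∧ EqOn (s i).integrand (fun p => (α i : ℝ) / ((ν : ℝ) - ∏ l, p l)) (cube i)) ∧
      (0 : FormalRep) - ∑ i ∈ Finset.range (w + 1), KZ.of (s i) ∈ KZ.relations := by
  choose s hs hsi using fun i => exists_nfRep (i := i) hν 0
  refine ⟨fun _ => 0, s, fun i => ⟨hs i, hsi i⟩, ?_⟩
  rw [zero_sub, neg_mem_iff]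
  refine KZ.relations.sum_mem fun i _ => ?_
  exact carrier_zero (D := cube i) (fun α p => (α : ℝ) / ((ν : ℝ) - ∏ l, p l)) (fun x => by simp) (hs i) (hsi i)

/-- Congruence: if `x − y` is a relation and `y` has a normal form, so has `x`. [cite: KontsevichZagier2001, §1.2] -/
theorem gnf_congr {ν : ℚ} {w : ℕ} {x y : FormalRep} (hxy : x - y ∈ KZ.relations)
    (hy : ∃ (α : ℕ → ℚ) (s : (i : ℕ) → IntegralRep i),
      (∀ i, (s i).domain = cube i ∧ EqOn (s i).integrand (fun p => (α i : ℝ) / ((ν : ℝ) - ∏ l, p l)) (cube i)) ∧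
      y - ∑ i ∈ Finset.range (w + 1), KZ.of (s i) ∈ KZ.relations) :
    ∃ (α : ℕ → ℚ) (s : (i : ℕ) → IntegralRep i),
      (∀ i, (s i).domain = cube i ∧ EqOn (s i).integrand (fun p => (α i : ℝ) / ((ν : ℝ) - ∏ l, p l)) (cube i)) ∧
      x - ∑ i ∈ Finset.range (w + 1), KZ.of (s i) ∈ KZ.relations := by
  obtain ⟨α, s, hs, h⟩ := hy
  refine ⟨α, s, hs, ?_⟩
  have : x - ∑ i ∈ Finset.range (w + 1), KZ.of (s i) =
      (x - y) + (y - ∑ i ∈ Finset.range (w + 1), KZ.of (s i)) := by abel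
  rw [this]
  exact KZ.relations.add_mem hxy h

/-- Sum of normal forms (rule 1b on each carrier). [cite: KontsevichZagier2001, §1.2 rule (1)] -/
theorem gnf_add {ν : ℚ} {w : ℕ} (hν : 1 < ν ∨ ν < 0) {x y : FormalRep}
    (hx : ∃ (α : ℕ → ℚ) (s : (i : ℕ) → IntegralRep i),
      (∀ i, (s i).domain = cube i ∧ EqOn (s i).integrand (fun p => (α i : ℝ) / ((ν : ℝ) - ∏ l, p l)) (cube i)) ∧
      x - ∑ i ∈ Finset.range (w + 1), KZ.of (s i) ∈ KZ.relations)
    (hy : ∃ (α : ℕ → ℚ) (s : (i : ℕ) → IntegralRep i),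
      (∀ i, (s i).domain = cube i ∧ EqOn (s i).integrand (fun p => (α i : ℝ) / ((ν : ℝ) - ∏ l, p l)) (cube i)) ∧
      y - ∑ i ∈ Finset.range (w + 1), KZ.of (s i) ∈ KZ.relations) :
    ∃ (α : ℕ → ℚ) (s : (i : ℕ) → IntegralRep i),
      (∀ i, (s i).domain = cube i ∧ EqOn (s i).integrand (fun p => (α i : ℝ) / ((ν : ℝ) - ∏ l, p l)) (cube i)) ∧
      (x + y) - ∑ i ∈ Finset.range (w + 1), KZ.of (s i) ∈ KZ.relations := by
  obtain ⟨α, s, hs, h⟩ := hx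
  obtain ⟨α', t, ht, h'⟩ := hy
  choose u hu hui using fun i => exists_nfRep (i := i) hν (α i + α' i)
  have e : ∀ i, KZ.of (u i) - KZ.of (s i) - KZ.of (t i) ∈ KZ.relations := fun i =>
    carrier_add (D := cube i) (fun α p => (α : ℝ) / ((ν : ℝ) - ∏ l, p l)) (nfFamily_add ν i)
      (hs i).1 (hs i).2 (ht i).1 (ht i).2 (hu i) (hui i)
  refine ⟨fun i => α i + α' i, u, fun i => ⟨hu i, hui i⟩, ?_⟩
  have : x + y - ∑ i ∈ Finset.range (w + 1), KZ.of (u i) =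
      (x - ∑ i ∈ Finset.range (w + 1), KZ.of (s i)) + (y - ∑ i ∈ Finset.range (w + 1), KZ.of (t i))
        - ∑ i ∈ Finset.range (w + 1), (KZ.of (u i) - KZ.of (s i) - KZ.of (t i)) := by
    simp only [Finset.sum_sub_distrib]; abel
  rw [this]
  exact KZ.relations.sub_mem (KZ.relations.add_mem h h') (KZ.relations.sum_mem fun i _ => e i)

/-- Negative of a normal form (rule 1b on each carrier). [cite: KontsevichZagier2001, §1.2 rule (1)] -/
theorem gnf_neg {ν : ℚ} {w : ℕ} (hν : 1 < ν ∨ ν < 0) {x : FormalRep}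
    (hx : ∃ (α : ℕ → ℚ) (s : (i : ℕ) → IntegralRep i),
      (∀ i, (s i).domain = cube i ∧ EqOn (s i).integrand (fun p => (α i : ℝ) / ((ν : ℝ) - ∏ l, p l)) (cube i)) ∧
      x - ∑ i ∈ Finset.range (w + 1), KZ.of (s i) ∈ KZ.relations) :
    ∃ (α : ℕ → ℚ) (s : (i : ℕ) → IntegralRep i),
      (∀ i, (s i).domain = cube i ∧ EqOn (s i).integrand (fun p => (α i : ℝ) / ((ν : ℝ) - ∏ l, p l)) (cube i)) ∧
      (-x) - ∑ i ∈ Finset.range (w + 1), KZ.of (s i) ∈ KZ.relations := by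
  obtain ⟨α, s, hs, h⟩ := hx
  choose t ht hti using fun i => exists_nfRep (i := i) hν (-α i)
  choose u hu hui using fun i => exists_nfRep (i := i) hν (α i + -α i)
  have e : ∀ i, KZ.of (u i) - KZ.of (s i) - KZ.of (t i) ∈ KZ.relations := fun i =>
    carrier_add (D := cube i) (fun α p => (α : ℝ) / ((ν : ℝ) - ∏ l, p l)) (nfFamily_add ν i)
      (hs i).1 (hs i).2 (ht i) (hti i) (hu i) (hui i)
  have z : ∀ i, KZ.of (u i) ∈ KZ.relations := fun i =>
    carrier_zero (D := cube i) (fun α p => (α : ℝ) / ((ν : ℝ) - ∏ l, p l)) (fun x => by simp) (hu i)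
      (by have := hui i; rw [add_neg_cancel] at this; exact this)
  refine ⟨fun i => -α i, t, fun i => ⟨ht i, hti i⟩, ?_⟩
  have : -x - ∑ i ∈ Finset.range (w + 1), KZ.of (t i) =
      -(x - ∑ i ∈ Finset.range (w + 1), KZ.of (s i))
        + ∑ i ∈ Finset.range (w + 1), (KZ.of (u i) - KZ.of (s i) - KZ.of (t i))
        - ∑ i ∈ Finset.range (w + 1), KZ.of (u i) := by
    simp only [Finset.sum_sub_distrib]; abel
  rw [this]
  exact KZ.relations.sub_mem (KZ.relations.add_mem (KZ.relations.neg_mem h)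
    (KZ.relations.sum_mem fun i _ => e i)) (KZ.relations.sum_mem fun i _ => z i)

/-- A single normal-form carrier in dimension `i ≤ w` has a normal form (zero carriers elsewhere).
[cite: KontsevichZagier2001, §1.2 rule (1)] -/
theorem gnf_single {ν : ℚ} {w : ℕ} (hν : 1 < ν ∨ ν < 0) {i : ℕ} (hi : i ≤ w) (β : ℚ) {x : FormalRep}
    (hx : ∃ s : IntegralRep i, s.domain = cube i ∧
      EqOn s.integrand (fun p => (β : ℝ) / ((ν : ℝ) - ∏ l, p l)) (cube i) ∧ x - KZ.of s ∈ KZ.relations) :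
    ∃ (α : ℕ → ℚ) (s : (i : ℕ) → IntegralRep i),
      (∀ i, (s i).domain = cube i ∧ EqOn (s i).integrand (fun p => (α i : ℝ) / ((ν : ℝ) - ∏ l, p l)) (cube i)) ∧
      x - ∑ i ∈ Finset.range (w + 1), KZ.of (s i) ∈ KZ.relations := by
  classical
  obtain ⟨s₀, hs₀, hs₀i, h⟩ := hx
  -- zero carriers everywhere, `s₀` at index `i`
  choose z hz hzi using fun k => exists_nfRep (i := k) hν 0
  have hzr : ∀ k, KZ.of (z k) ∈ KZ.relations := fun k =>
    carrier_zero (D := cube k) (fun α p => (α : ℝ) / ((ν : ℝ) - ∏ l, p l)) (fun x => by simp) (hz k) (hzi k)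
  -- the family: replace index `i`
  let s : (k : ℕ) → IntegralRep k := fun k => if hk : k = i then hk ▸ s₀ else z k
  have hsi : s i = s₀ := by simp [s]
  have hsk : ∀ k, k ≠ i → s k = z k := fun k hk => by simp [s, hk]
  refine ⟨fun k => if k = i then β else 0, s, fun k => ?_, ?_⟩
  · by_cases hk : k = i
    · subst hk; rw [hsi]; exact ⟨hs₀, by simpa using hs₀i⟩
    · rw [hsk k hk]; exact ⟨hz k, by simpa [hk] using hzi k⟩
  · have hmem : i ∈ Finset.range (w + 1) := Finset.mem_range.2 (Nat.lt_succ_of_le hi)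
    rw [← Finset.add_sum_erase _ _ hmem, hsi]
    have hrest : ∑ k ∈ (Finset.range (w + 1)).erase i, KZ.of (s k) ∈ KZ.relations :=
      KZ.relations.sum_mem fun k hk => by
        rw [hsk k (Finset.ne_of_mem_erase hk)]; exact hzr k
    have : x - (KZ.of s₀ + ∑ k ∈ (Finset.range (w + 1)).erase i, KZ.of (s k)) =
        (x - KZ.of s₀) - ∑ k ∈ (Finset.range (w + 1)).erase i, KZ.of (s k) := by abel
    rw [this]
    exact KZ.relations.sub_mem h hrest

/-- A finite sum of normal forms is a normal form. [cite: KontsevichZagier2001, §1.2 rule (1)] -/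
theorem gnf_sum {ν : ℚ} {w : ℕ} (hν : 1 < ν ∨ ν < 0) {ι : Type*} (S : Finset ι) (x : ι → FormalRep)
    (hx : ∀ k ∈ S, ∃ (α : ℕ → ℚ) (s : (i : ℕ) → IntegralRep i),
      (∀ i, (s i).domain = cube i ∧ EqOn (s i).integrand (fun p => (α i : ℝ) / ((ν : ℝ) - ∏ l, p l)) (cube i)) ∧
      x k - ∑ i ∈ Finset.range (w + 1), KZ.of (s i) ∈ KZ.relations) :
    ∃ (α : ℕ → ℚ) (s : (i : ℕ) → IntegralRep i),
      (∀ i, (s i).domain = cube i ∧ EqOn (s i).integrand (fun p => (α i : ℝ) / ((ν : ℝ) - ∏ l, p l)) (cube i)) ∧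
      (∑ k ∈ S, x k) - ∑ i ∈ Finset.range (w + 1), KZ.of (s i) ∈ KZ.relations := by
  classical
  induction S using Finset.induction_on with
  | empty => simpa using gnf_zero hν w
  | insert a S ha ih =>
    rw [Finset.sum_insert ha]
    exact gnf_add hν (hx a (Finset.mem_insert_self a S)) (ih fun k hk => hx k (Finset.mem_insert_of_mem hk))

/-- A rational constant `[pt, c]` congruence class has a normal form (index `0`: `c = β/(ν − 1)` with
`β = c (ν − 1)`). [cite: KontsevichZagier2001, §1.2 rule (1)] -/
theorem gnf_const {ν : ℚ} {w : ℕ} (hν : 1 < ν ∨ ν < 0) (c : ℚ) {x : FormalRep}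
    (hx : ∃ s₀ : IntegralRep 0, s₀.domain = cube 0 ∧ EqOn s₀.integrand (fun _ => (c : ℝ)) (cube 0) ∧
      x - KZ.of s₀ ∈ KZ.relations) :
    ∃ (α : ℕ → ℚ) (s : (i : ℕ) → IntegralRep i),
      (∀ i, (s i).domain = cube i ∧ EqOn (s i).integrand (fun p => (α i : ℝ) / ((ν : ℝ) - ∏ l, p l)) (cube i)) ∧
      x - ∑ i ∈ Finset.range (w + 1), KZ.of (s i) ∈ KZ.relations := by
  obtain ⟨s₀, hs₀, hs₀i, h⟩ := hx
  obtain ⟨s, hs, hsi⟩ := exists_nfRep (i := 0) hν (c * (ν - 1))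
  have hN1 : (ν : ℝ) - 1 ≠ 0 := nu_sub_one_ne hν
  have e : KZ.of s₀ - KZ.of s ∈ KZ.relations := by
    refine of_sub_of_mem_relations_of_eqOn (hs.trans hs₀.symm) fun p hp => ?_
    rw [hs₀] at hp
    rw [hs₀i hp, hsi hp]
    simp only [Finset.univ_eq_empty, Finset.prod_empty, Rat.cast_mul, Rat.cast_sub, Rat.cast_one]
    field_simp
  refine gnf_single hν (Nat.zero_le w) (c * (ν - 1)) ⟨s, hs, hsi, ?_⟩
  have : x - KZ.of s = (x - KZ.of s₀) + (KZ.of s₀ - KZ.of s) := by abel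
  rw [this]
  exact KZ.relations.add_mem h e

/-! ## The general reduction -/

/-- **The general reduction** (rational level `ν > 1` or `ν < 0`): every rescaled generator
`[□ʲ, q x^a/(ν − ∏x)^m]` with `j ≤ w` reduces modulo `KZ.relations` to a rational normal form
`Σ_{i ≤ w} [□ⁱ, αᵢ/(ν − ∏x)]`. Induction on `j`, then on
`m`: `j = 0` constants; `m = 0` monomials (`stub_monomialGen`); unbalanced exponents: torus exactness
(`stub_torusGen`) to two faces of dimension `j − 1`; balanced: `m = 1` division (`stub_divisionGen`),
`m = k + 2` Euler descent (`stub_eulerGen`). [cite: KontsevichZagier2001, §1.2] -/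
theorem genReduction {ν : ℚ} {w : ℕ} (hν : 1 < ν ∨ ν < 0) : ∀ (j : ℕ), j ≤ w → ∀ (m : ℕ) (q : ℚ) (a : Fin j → ℕ)
    (r : IntegralRep j), r.domain = cube j →
    EqOn r.integrand (fun p => (q : ℝ) * (∏ l, p l ^ a l) / ((ν : ℝ) - ∏ l, p l) ^ m) (cube j) →
    ∃ (α : ℕ → ℚ) (s : (i : ℕ) → IntegralRep i),
      (∀ i, (s i).domain = cube i ∧ EqOn (s i).integrand (fun p => (α i : ℝ) / ((ν : ℝ) - ∏ l, p l)) (cube i)) ∧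
      KZ.of r - ∑ i ∈ Finset.range (w + 1), KZ.of (s i) ∈ KZ.relations := by
  intro j
  induction j with
  | zero =>
    -- dimension 0: the generator is the rational constant `q/(ν − 1)^m`
    intro _ m q a r hr hri
    have hN1 : (ν : ℝ) - 1 ≠ 0 := nu_sub_one_ne hν
    obtain ⟨s₀, hs₀, hs₀i⟩ := exists_nf0 (q / (ν - 1) ^ m)
    refine gnf_const hν (q / (ν - 1) ^ m) ⟨s₀, hs₀, hs₀i, ?_⟩
    refine of_sub_of_mem_relations_of_eqOn (hs₀.trans hr.symm) fun p hp => ?_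
    rw [hr] at hp
    rw [hri hp, hs₀i hp]
    simp [Finset.univ_eq_empty]
  | succ j ihj =>
    intro hjw m
    induction m using Nat.strong_induction_on with
    | _ m ihm =>
    intro q a r hr hri
    rcases Nat.eq_zero_or_pos m with rfl | hmpos
    · -- `m = 0`: a monomial
      obtain ⟨s₀, hs₀, hs₀i⟩ := exists_nf0 (q / ∏ l, ((a l : ℚ) + 1))
      refine gnf_const hν (q / ∏ l, ((a l : ℚ) + 1)) ⟨s₀, hs₀, hs₀i, ?_⟩
      exact stub_monomialGen (j + 1) q a r s₀ hr (fun p hp => by rw [hri hp]; simp) hs₀ hs₀i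
    by_cases hbal : ∀ i, a i = a 0
    · -- balanced: `a = (c, …, c)`
      have ha : a = fun _ => a 0 := funext hbal
      rcases m with _ | _ | k
      · exact absurd hmpos (lt_irrefl 0)
      · -- `m = 1`: division
        obtain ⟨s, hs, hsi⟩ := exists_nfRep (i := j + 1) hν (q * ν ^ (a 0))
        choose t ht hti using fun i : ℕ => exists_genRep (j := j + 1) hν (q * ν ^ (a 0 - 1 - i)) (fun _ => i) 0
        have hdiv := divisionGen (j + 1) ν hν q (a 0) r s t hr (fun p hp => by rw [hri hp, ha])
          hs (fun p hp => by rw [hsi hp]; simp) (fun i _ => ⟨ht i, hti i⟩)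
        have hS := gnf_single hν hjw (q * ν ^ (a 0)) ⟨s, hs, hsi, by rw [sub_self]; exact KZ.relations.zero_mem⟩
        have hT : ∀ i ∈ Finset.range (a 0), ∃ (α : ℕ → ℚ) (u : (i : ℕ) → IntegralRep i),
            (∀ i, (u i).domain = cube i ∧ EqOn (u i).integrand (fun p => (α i : ℝ) / ((ν : ℝ) - ∏ l, p l)) (cube i)) ∧
            KZ.of (t i) - ∑ i ∈ Finset.range (w + 1), KZ.of (u i) ∈ KZ.relations := fun i _ =>
          ihm 0 Nat.one_pos _ _ (t i) (ht i) (hti i)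
        refine gnf_congr ?_ (gnf_add hν hS (gnf_neg hν (gnf_sum hν _ _ hT)))
        rwa [← sub_eq_add_neg]
      · -- `m = k + 2`: Euler descent
        obtain ⟨r₁, hr₁, hr₁i⟩ := exists_genRep (j := j) hν (q / (ν * ((k : ℚ) + 1)))
          (fun l => a (Fin.castSucc l)) (k + 1)
        obtain ⟨r', hr', hr'i⟩ := exists_genRep (j := j + 1) hν
          (q * ((k : ℚ) - a (Fin.last j)) / (ν * ((k : ℚ) + 1))) a (k + 1)
        have he := eulerGen j ν hν q a k r r₁ r' hr hri hr₁ hr₁i hr' hr'i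
        have h₁ := ihj (Nat.le_of_succ_le hjw) (k + 1) _ _ r₁ hr₁ hr₁i
        have h' := ihm (k + 1) (by omega) _ a r' hr' hr'i
        exact gnf_congr he (gnf_add hν h₁ h')
    · -- unbalanced: torus exactness along `i` and `0`
      obtain ⟨i, hi⟩ := not_forall.mp hbal
      have hi0 : i ≠ 0 := fun h => hi (h ▸ rfl)
      obtain ⟨r₁, hr₁, hr₁i⟩ := exists_genRep (j := j) hν (q / ((a i : ℚ) - a 0)) (fun l => a (i.succAbove l)) m
      obtain ⟨r₂, hr₂, hr₂i⟩ := exists_genRep (j := j) hν (q / ((a i : ℚ) - a 0))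
        (fun l => a ((0 : Fin (j + 1)).succAbove l)) m
      have ht := torusGen j ν hν q a m i 0 hi0 hi r r₁ r₂ hr hri hr₁ hr₁i hr₂ hr₂i
      have h₁ := ihj (Nat.le_of_succ_le hjw) m _ _ r₁ hr₁ hr₁i
      have h₂ := ihj (Nat.le_of_succ_le hjw) m _ _ r₂ hr₂ hr₂i
      refine gnf_congr ?_ (gnf_add hν h₁ (gnf_neg hν h₂))
      rwa [← sub_eq_add_neg]

/-! ## Integer levels (the registered form) -/

/-- An integer `N ≥ 2` is a rational level `> 1`. [folklore] -/
theorem natLevel {N : ℕ} (hN : 2 ≤ N) : (1 : ℚ) < N ∨ (N : ℚ) < 0 := Or.inl (by exact_mod_cast hN)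

/-- **Registered form** of `genReduction` at an integer level (crux stub `stub_genReduction`).
[cite: KontsevichZagier2001, §1.2] -/
theorem stub_genReduction : ∀ (N w : ℕ), 2 ≤ N → ∀ (j : ℕ), j ≤ w → ∀ (m : ℕ) (q : ℚ) (a : Fin j → ℕ)
    (r : IntegralRep j), r.domain = cube j →
    EqOn r.integrand (fun p => (q : ℝ) * (∏ l, p l ^ a l) / ((N : ℝ) - ∏ l, p l) ^ m) (cube j) →
    ∃ (α : ℕ → ℚ) (s : (i : ℕ) → IntegralRep i),
      (∀ i, (s i).domain = cube i ∧ EqOn (s i).integrand (fun p => (α i : ℝ) / ((N : ℝ) - ∏ l, p l)) (cube i)) ∧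
      KZ.of r - ∑ i ∈ Finset.range (w + 1), KZ.of (s i) ∈ KZ.relations := by
  intro N w hN j hjw m q a r hr hri
  have h := genReduction (w := w) (natLevel hN) j hjw m q a r hr (fun p hp => by rw [hri hp]; push_cast; rfl)
  simpa only [Rat.cast_natCast] using h

end Summit.KontsevichZagierPeriods.HermiteRigidity.ReductionRigidity

end
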